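import HarnessLib
import Summits.QuantumFields.YangMills.Theorems.PencilRigidityHypercubicLimitDefs
import Summits.QuantumFields.YangMills.Theorems.LangevinControlUVOSLegsFromFemtoAndGapDefs
import Summits.QuantumFields.YangMills.Theorems.LangevinControlUVOSLegsFromFemtoAndGapStubAssemblyLatticeDist
import Summits.QuantumFields.YangMills.Theorems.LangevinControlUVOSLegsFromFemtoAndGapStubAssemblyLowDegree
import Summits.QuantumFields.YangMills.Theorems.LangevinControlUVOSLegsFromFemtoAndGapStubAssemblyNontrivial

/-!
# Route `PencilRigidity`, crux `HypercubicLimit` (stmt-QuantumFields-8646), line `conditional-mean-telescoping`: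
the non-Gaussian leg of the closure

Pure proof file for two registered sub-goals of the (S) leg of the closure (lead reshape 3, c2 wave 1):

* `nonGaussian_of_scaledQ3` — non-Gaussianity of a scaled subsequential limit `S₁` from a scaled `Q3` floor.
  The closure builds the one-field continuum family `S₁` as the limit of the NORMALISED lattice distributions
  `(c_k a_k⁴)ⁿ · latticeDist` (normalisation `c_k = N_k^{-1/2}`).  With `S₁ 1 = 0` the cumulant combination of
  `OSData.IsNonGaussian` collapses to `S₁ 3 (f ⊗ g ⊗ h)`; pairwise disjoint supports put the real tensor
  `f ⊗ g ⊗ h` in `⁰𝒮` (sibling `isOffDiagonal_of_disjoint_three`), so it is the limit of the scaled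
  approximants, which by the sibling `latticeDist_three_tensor` are the reals `(c_k a_k⁴)³ Q3(f, g, h)`,
  eventually of absolute value `≥ ε`; closedness gives `‖S₁ 3 (f ⊗ g ⊗ h)‖ ≥ ε > 0`.  (The sibling crux's
  `nonGaussian_of_lowerBounds`, `Theorems/LangevinControlUVOSLegsFromFemtoAndGapStubAssemblyNontrivial.lean`,
  with the real scalar `(c_k a_k⁴)³` carried along and the floor as an `∀ᶠ` hypothesis.)
* `smearedThreePoint_eq_mul_Q3` — the line's smeared connected three-point function of the centred action
  density (`Theorems/PencilRigidityHypercubicLimitDefs.lean` §0, Riemann normalisation `a¹²`) is `a¹²` times the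
  sibling crux's bare `Q3` (`Theorems/LangevinControlUVOSLegsFromFemtoAndGapDefs.lean`): the line's
  `torusDensity r (2S+1) x U` is the sibling's `dens G r x (torusLift (2S+1) U)` (both
  `r.curvature.F (configShift (-x) ·)` of the periodic lift), its torus mean is the site-independent
  `wilsonTorusMean` (`torusE_dens_eq_wilsonTorusMean`), and the centred third moment is the third cumulant
  `torusK3` (sibling `torusMoment_three`).

Refs: line card `Cruxes/HypercubicLimit/Lines/conditional-mean-telescoping.md`; OsterwalderSchrader1973 §2;
GlimmJaffe1987 §6.1.
-/

set_option autoImplicit false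

noncomputable section

open scoped SchwartzMap ENNReal
open MeasureTheory Filter Topology
open Literature.MathematicalPhysics.AQFT Literature.MathematicalPhysics.QuantumLattice
open Literature.MathematicalPhysics.QuantumFieldTheory
open Literature.Probability.LatticeModels (box Site)
open Summit.QuantumFields.YangMills.Theorems.HypercubicLimit.Negative
  (torusPlaquette torusDensity rpSquare influence)
open Summit.QuantumFields.YangMills.Theorems.OSLegsFromFemtoAndGap (torusMomentStr latticeDistStr latticeDist)
open Summit.QuantumFields.YangMills.Cruxes.OSLegsFromFemtoAndGap.DlrCollarTransfer (Q2 Q3)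

namespace Summit.QuantumFields.YangMills.Cruxes.HypercubicLimit.ConditionalMeanTelescoping

open Summit.QuantumFields.YangMills.Theorems.OSLegsFromFemtoAndGap
  (torusMoment torusMoment_three latticeDist_three_tensor isOffDiagonal_of_disjoint_three
    torusE_dens_eq_wilsonTorusMean)
open Summit.QuantumFields.YangMills.Cruxes.OSLegsFromFemtoAndGap.DlrCollarTransfer (torusK3)

/-! ### Non-Gaussianity of a scaled limit -/

/-- **Non-Gaussianity of a scaled limit from a scaled `Q3` floor.**  If the scaled centred lattice three-point
distributions `(c_k a_k⁴)³ · latticeDist … 3` converge on `⁰𝒮` to `S₁ 3`, `S₁ 1 = 0`, and for three real test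
functions with pairwise disjoint supports eventually `ε ≤ |(c_k a_k⁴)³ Q3(f, g, h)|`, then the
`IsNonGaussian` cumulant combination of `S₁` on `f ⊗ g ⊗ h` (any tensor witnesses) is non-zero. -/
theorem nonGaussian_of_scaledQ3 :
    ∀ (G : Type) [Group G] [TopologicalSpace G] [IsTopologicalGroup G] [CompactSpace G] [MeasurableSpace G]
      [BorelSpace G] (r : LatticeRep G) (βs : ℕ → ℝ) (Ls : ℕ → ℕ) (as cs : ℕ → ℝ)
      (S₁ : SchwingerFamily (EuclideanSpace ℝ (Fin 4))) (f g h : 𝓢(EuclideanSpace ℝ (Fin 4), ℝ)) (ε : ℝ),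
      0 < ε → Disjoint (tsupport f) (tsupport g) → Disjoint (tsupport g) (tsupport h) →
      Disjoint (tsupport f) (tsupport h) →
      (∀ F : 𝓢((Fin 1 → EuclideanSpace ℝ (Fin 4)), ℂ), S₁ 1 F = 0) →
      (∀ F : 𝓢((Fin 3 → EuclideanSpace ℝ (Fin 4)), ℂ), IsOffDiagonal F →
        Tendsto (fun k => (((cs k * as k ^ 4) ^ 3 : ℝ) : ℂ) *
          latticeDist r.ρ (βs k) (Ls k) (as k) r.curvature.F (wilsonTorusMean r.ρ (βs k) (Ls k) r.curvature.F) 3 F)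
          atTop (𝓝 (S₁ 3 F))) →
      (∀ᶠ k in atTop, ε ≤ |(cs k * as k ^ 4) ^ 3 * Q3 G r (βs k) (Ls k) (as k) f g h|) →
      ∃ (f' g' h' : 𝓢(EuclideanSpace ℝ (Fin 4), ℂ)) (Ffgh : 𝓢((Fin 3 → EuclideanSpace ℝ (Fin 4)), ℂ))
        (Fgh Ffh Ffg : 𝓢((Fin 2 → EuclideanSpace ℝ (Fin 4)), ℂ)) (Ff Fg Fh : 𝓢((Fin 1 → EuclideanSpace ℝ (Fin 4)), ℂ)),
        IsTensorOf Ffgh ![f', g', h'] ∧ IsOffDiagonal Ffgh ∧ IsTensorOf Fgh ![g', h'] ∧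
        IsTensorOf Ffh ![f', h'] ∧ IsTensorOf Ffg ![f', g'] ∧ IsTensorOf Ff ![f'] ∧ IsTensorOf Fg ![g'] ∧
        IsTensorOf Fh ![h'] ∧
          S₁ 3 Ffgh - S₁ 1 Ff * S₁ 2 Fgh - S₁ 1 Fg * S₁ 2 Ffh - S₁ 1 Fh * S₁ 2 Ffg +
            2 * (S₁ 1 Ff * S₁ 1 Fg * S₁ 1 Fh) ≠ 0 := by
  intro G _ _ _ _ _ _ r βs Ls as cs S₁ f g h ε hε hfg hgh hfh h1 hconv hfloor
  set T3 : 𝓢((Fin 3 → EuclideanSpace ℝ (Fin 4)), ℂ) :=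
    SchwartzMap.tensorFin 3 ![ofRealTest f, ofRealTest g, ofRealTest h]
  have hT3 : IsTensorOf T3 ![ofRealTest f, ofRealTest g, ofRealTest h] := isTensorOf_tensorFin _
  have hT3' : IsTensorOf T3 (fun i => ofRealTest (![f, g, h] i)) := by
    intro x; rw [hT3 x]
    congr 1; funext i; fin_cases i <;> rfl
  have hod : IsOffDiagonal T3 := isOffDiagonal_of_disjoint_three hfg hgh hfh hT3
  refine ⟨ofRealTest f, ofRealTest g, ofRealTest h, T3,
    SchwartzMap.tensorFin 2 ![ofRealTest g, ofRealTest h], SchwartzMap.tensorFin 2 ![ofRealTest f, ofRealTest h],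
    SchwartzMap.tensorFin 2 ![ofRealTest f, ofRealTest g], SchwartzMap.tensorFin 1 ![ofRealTest f],
    SchwartzMap.tensorFin 1 ![ofRealTest g], SchwartzMap.tensorFin 1 ![ofRealTest h], hT3, hod,
    isTensorOf_tensorFin _, isTensorOf_tensorFin _, isTensorOf_tensorFin _, isTensorOf_tensorFin _,
    isTensorOf_tensorFin _, isTensorOf_tensorFin _, ?_⟩
  simp only [h1, zero_mul, sub_zero, mul_zero, add_zero]
  -- `S₁ 3 (f ⊗ g ⊗ h)` is the limit of the reals `(c_k a_k⁴)³ Q3(f, g, h)`, eventually `|·| ≥ ε`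
  have hlim := hconv T3 hod
  have hQ3 : ∀ k, (((cs k * as k ^ 4) ^ 3 : ℝ) : ℂ) *
      latticeDist r.ρ (βs k) (Ls k) (as k) r.curvature.F (wilsonTorusMean r.ρ (βs k) (Ls k) r.curvature.F) 3 T3 =
        (((cs k * as k ^ 4) ^ 3 * Q3 G r (βs k) (Ls k) (as k) f g h : ℝ) : ℂ) := fun k => by
    rw [latticeDist_three_tensor r _ _ _ f g h _ hT3', Complex.ofReal_mul]
  have hnorm : Tendsto (fun k => ‖(((cs k * as k ^ 4) ^ 3 : ℝ) : ℂ) *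
      latticeDist r.ρ (βs k) (Ls k) (as k) r.curvature.F (wilsonTorusMean r.ρ (βs k) (Ls k) r.curvature.F) 3 T3‖)
      atTop (𝓝 ‖S₁ 3 T3‖) :=
    (continuous_norm.tendsto _).comp hlim
  have hge : ε ≤ ‖S₁ 3 T3‖ :=
    ge_of_tendsto hnorm (hfloor.mono fun k hk => by rw [hQ3 k, Complex.norm_real, Real.norm_eq_abs]; exact hk)
  intro h0
  rw [h0, norm_zero] at hge
  linarith

/-! ### The line's smeared three-point function vs the sibling's `Q3` -/

/-- The centred third moment of the line's torus action densities at `x, y, z` (centring by their own torus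
means) is the sibling crux's third cumulant `torusK3 G r β S x y z`. -/
theorem integral_centred_torusDensity_three {G : Type} [Group G] [TopologicalSpace G] [IsTopologicalGroup G]
    [CompactSpace G] [MeasurableSpace G] [BorelSpace G] (r : LatticeRep G) (β : ℝ) (S : ℕ) (x y z : Site 4) :
    ∫ U, (torusDensity r (2 * S + 1) x U -
          ∫ V, torusDensity r (2 * S + 1) x V ∂(wilsonMeasure (d := 4) (L := 2 * S + 1) r.ρ β)) *
        (torusDensity r (2 * S + 1) y U -
          ∫ V, torusDensity r (2 * S + 1) y V ∂(wilsonMeasure (d := 4) (L := 2 * S + 1) r.ρ β)) *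
        (torusDensity r (2 * S + 1) z U -
          ∫ V, torusDensity r (2 * S + 1) z V ∂(wilsonMeasure (d := 4) (L := 2 * S + 1) r.ρ β))
      ∂(wilsonMeasure (d := 4) (L := 2 * S + 1) r.ρ β) = torusK3 G r β S x y z := by
  have hm : ∀ w : Site 4, ∫ V, torusDensity r (2 * S + 1) w V ∂(wilsonMeasure (d := 4) (L := 2 * S + 1) r.ρ β) =
      wilsonTorusMean r.ρ β S r.curvature.F := fun w =>
    torusE_dens_eq_wilsonTorusMean (G := G) r β S w
  have h3 := torusMoment_three (G := G) r β S ![x, y, z]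
  simp only [Matrix.cons_val_zero, Matrix.cons_val_one, Matrix.cons_val] at h3
  rw [← h3, hm, hm, hm]
  unfold torusMoment
  simp only [Fin.prod_univ_three, Matrix.cons_val_zero, Matrix.cons_val_one, Matrix.cons_val]
  rfl

/-- **The line's smeared three-point function is `a¹²` times the sibling's `Q3`.** -/
theorem smearedThreePoint_eq_mul_Q3 :
    ∀ (G : Type) [Group G] [TopologicalSpace G] [IsTopologicalGroup G] [CompactSpace G] [MeasurableSpace G]
      [BorelSpace G] (r : LatticeRep G) (β : ℝ) (S : ℕ) (a : ℝ) (φ₁ φ₂ φ₃ : 𝓢(EuclideanSpace ℝ (Fin 4), ℝ)),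
      smearedThreePoint r β S a φ₁ φ₂ φ₃ = a ^ 12 * Q3 G r β S a φ₁ φ₂ φ₃ := by
  intro G _ _ _ _ _ _ r β S a φ₁ φ₂ φ₃
  unfold smearedThreePoint Q3
  simp only [integral_centred_torusDensity_three]

end Summit.QuantumFields.YangMills.Cruxes.HypercubicLimit.ConditionalMeanTelescoping

end
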